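import Summits.MatrixMultiplication.MatrixMultiplication.Theses.HollowSchoolbook
import Literature.Computability.AlgebraicComplexity.BorderRankFlattening

/-!
# Line `hook-and-dearest` for crux `HollowSchoolbook.ColumnStep` (stmt-MatrixMultiplication-15898)

`ColumnStep : ∀ a b c, bR⟨a+1,b+1,c+2⟩ ≤ bR⟨a+1,b+1,c+1⟩ + a + b + 1`
(`bR = algBorderRank ∘ matMulTensor ℂ`: each extra column of `B` costs at most the hook `a+b−1`).

The column step is EXACTLY "the second column is cheap" ∧ "no later column is dearer than the
second" (the rectangular, exact form of route `MarginalColumns`' thesis `C ∧ D`):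

* `stub_twoColumnHook`      — C_rect: `bR⟨a,b,2⟩ ≤ ab + a + b − 1` (the `c = 1` instance of the
  step over the exact one-column value `bR⟨a,b,1⟩ = ab`; generalises `TwoColumns`, `TowerTwoTwo`,
  `FourFourTwo`; sub-plan: reduced gluing à la Landsberg–Ryder Prop. 3.1 in the format `⟨b,2,a⟩`,
  see the line card);
* `stub_secondColumnDearest` — D_rect: `bR⟨a,b,c+2⟩ + bR⟨a,b,1⟩ ≤ bR⟨a,b,c+1⟩ + bR⟨a,b,2⟩`
  (its `a = b` case is `MarginalColumns.SecondColumnDominates`, stmt-MatrixMultiplication-16310,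
  verbatim up to the index shift `n = a+1, w = c+1`);
* `ColumnStep_of : ColumnStep` — the kernel-checked composition from the two stubs (through the sorry-free
  `columnStep_of_hook_of_dearest`: flattening `(a+1)(b+1) ≤ bR⟨a+1,b+1,1⟩` + omega).

Strategist unit cstrat-stmt-MatrixMultiplication-15898-r1, 2026-08-17.
-/

namespace Summit.MatrixMultiplication.MatrixMultiplication.Cruxes.ColumnStep.HookAndDearest

open Literature.Computability.AlgebraicComplexity

/-- STUB C_rect (two columns cost the hook): for all `a, b ≥ 1`, `bR⟨a,b,2⟩ ≤ ab + a + b − 1`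
(shifted `a+1, b+1`). Open from `(a,b) = (4,4)` (cell `bR⟨4,4,2⟩ ≤ 23`, printed window `[22,24]`)
and `(2,c)`, `c ≥ 8` (Landsberg's expected `(2,2)` tower); known `(2,2),(2,3),(3,3)` = 7, 10, 14 and
`(2,c)`, `c ≤ 7` (Smirnov, as quoted by CHL 2023 p. 4). -/
theorem stub_twoColumnHook :
    ∀ a b : ℕ, Literature.Computability.AlgebraicComplexity.algBorderRank
        (Literature.Computability.AlgebraicComplexity.matMulTensor ℂ (a + 1) (b + 1) 2) ≤
      (a + 1) * (b + 1) + a + b + 1 := by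
  sorry

/-- STUB D_rect (the second column is the dearest): for all `a, b ≥ 1` and `c ≥ 1`,
`bR⟨a,b,c+1⟩ − bR⟨a,b,c⟩ ≤ bR⟨a,b,2⟩ − bR⟨a,b,1⟩`, written subtraction-free (shifted `a+1, b+1`;
the `c = 0` instance is trivial). First open cell `(3,3,2→3)`: `bR⟨3,3,3⟩ ≤ 19` (window `[17,20]`). -/
theorem stub_secondColumnDearest :
    ∀ a b c : ℕ, Literature.Computability.AlgebraicComplexity.algBorderRank
          (Literature.Computability.AlgebraicComplexity.matMulTensor ℂ (a + 1) (b + 1) (c + 2)) +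
        Literature.Computability.AlgebraicComplexity.algBorderRank
          (Literature.Computability.AlgebraicComplexity.matMulTensor ℂ (a + 1) (b + 1) 1) ≤
      Literature.Computability.AlgebraicComplexity.algBorderRank
          (Literature.Computability.AlgebraicComplexity.matMulTensor ℂ (a + 1) (b + 1) (c + 1)) +
        Literature.Computability.AlgebraicComplexity.algBorderRank
          (Literature.Computability.AlgebraicComplexity.matMulTensor ℂ (a + 1) (b + 1) 2) := by
  sorry

/-- Flattening (conciseness of `⟨a+1,b+1,1⟩` along the `A`-slot): `(a+1)(b+1) ≤ bR⟨a+1,b+1,1⟩`.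
Proved from tree lemmas (`card_le_algBorderRank_of_linearIndependent`,
`linearIndependent_rotate_matMulTensor`, `algBorderRank_rotate`). -/
theorem mul_le_algBorderRank_matMulTensor_one (a b : ℕ) :
    (a + 1) * (b + 1) ≤ algBorderRank (matMulTensor ℂ (a + 1) (b + 1) 1) := by
  have h := card_le_algBorderRank_of_linearIndependent _
    (linearIndependent_rotate_matMulTensor ℂ (a + 1) (b + 1) 1)
  rw [algBorderRank_rotate] at h
  simpa [Fintype.card_prod, Fintype.card_fin] using h

/-- The assembly with explicit hypotheses (sorry-free; the text to land as
`Theorems/HollowSchoolbookColumnStepSplit.lean` if the route is ever split): C_rect → D_rect → `ColumnStep`.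
For each `(a,b,c)`:
`bR⟨·,·,c+2⟩ + (a+1)(b+1) ≤ bR⟨·,·,c+2⟩ + bR⟨·,·,1⟩ ≤ bR⟨·,·,c+1⟩ + bR⟨·,·,2⟩ ≤ bR⟨·,·,c+1⟩ + (a+1)(b+1) + a+b+1`. -/
theorem columnStep_of_hook_of_dearest :
    (∀ a b : ℕ, Literature.Computability.AlgebraicComplexity.algBorderRank
        (Literature.Computability.AlgebraicComplexity.matMulTensor ℂ (a + 1) (b + 1) 2) ≤
      (a + 1) * (b + 1) + a + b + 1) →
    (∀ a b c : ℕ, Literature.Computability.AlgebraicComplexity.algBorderRank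
          (Literature.Computability.AlgebraicComplexity.matMulTensor ℂ (a + 1) (b + 1) (c + 2)) +
        Literature.Computability.AlgebraicComplexity.algBorderRank
          (Literature.Computability.AlgebraicComplexity.matMulTensor ℂ (a + 1) (b + 1) 1) ≤
      Literature.Computability.AlgebraicComplexity.algBorderRank
          (Literature.Computability.AlgebraicComplexity.matMulTensor ℂ (a + 1) (b + 1) (c + 1)) +
        Literature.Computability.AlgebraicComplexity.algBorderRank
          (Literature.Computability.AlgebraicComplexity.matMulTensor ℂ (a + 1) (b + 1) 2)) →
    Summit.MatrixMultiplication.MatrixMultiplication.Theses.HollowSchoolbook.ColumnStep := by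
  intro hC hD a b c
  have h1 := hD a b c
  have h2 := hC a b
  have h3 := mul_le_algBorderRank_matMulTensor_one a b
  omega

/-- COMPOSITION: the crux `HollowSchoolbook.ColumnStep`, concluded BY NAME from the two DECLARED stubs
`stub_twoColumnHook` and `stub_secondColumnDearest` (the only `sorry`s of the file) through the sorry-free
`columnStep_of_hook_of_dearest`. -/
theorem ColumnStep_of :
    Summit.MatrixMultiplication.MatrixMultiplication.Theses.HollowSchoolbook.ColumnStep :=
  columnStep_of_hook_of_dearest stub_twoColumnHook stub_secondColumnDearest

end Summit.MatrixMultiplication.MatrixMultiplication.Cruxes.ColumnStep.HookAndDearest
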